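import Literature.Analysis.ODE.HeunEulerKernel
import HarnessLib

/-!
# Venture KdS — analysis toolkit for the Teukolsky–Starobinsky transfer (IV): the termwise Euler
# intertwining of Frobenius expansions at `w = 1` (pure algebra)

HONEST FRAMING (venture `Summits/Ventures/KdS`, cell `pub-kds`; LIT-1 g22 under lead ruling A86):
general-Heun ALGEBRA in Umetsu's normalisation (`GeneralHeun.lead/mid/low`, accessory sign `+q`),
no analysis and nothing about Kerr–de Sitter. It is the algebraic core of the treatment of the
NON-EXTREME strata of the cosmological lattice (`s ≥ 5/2`, `Re ω = mϖ₂`, `0 < Im ω ≤ (s−2)κ₂`),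
where the kernel of the Teukolsky–Starobinsky map contains polynomials of positive degree and the
explicit monomial partner of `RouteWSpinFlipLattice.lean` must be replaced by a general-degree one.

Contents. Writing `t = w − 1`, Umetsu's operator `M = lead ∂² + mid ∂ + low` (singular points
`0, 1, a_H`) acts on monomials by
`M[t^μ] = t^{μ−1}·(X₀(μ) + X₁(μ)·t + X₂(μ)·t²)` with
`X₀(μ) = (1−a_H)μ(μ−1+δ)`, `X₁(μ) = (2−a_H)μ(μ−1) + [γ(1−a_H)+δ(2−a_H)+ε]μ + αβ + q`,
`X₂(μ) = μ(μ−1) + (γ+δ+ε)μ + αβ` (`symX₀/₁/₂`; the analytic statement is in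
`SpinFlipFrobenius.lean`), so that `M[t^ρ Σ_k c_k t^k] = t^{ρ−1} Σ_n recCoeff_n t^n` with the
three-term recurrence `recCoeff`. For Takemura's parameter map of Euler's integral transformation
with exponent `η`, `(η−α)(η−β) = 0` (`GeneralHeun.eulerSrc*`, landed), the image symbol satisfies,
for EVERY `μ` (Fuchs relation assumed),
`X̃₀(μ+η−1)·μ = X₀(μ)·(μ+η−1)`, `X̃₁(μ+η−1) = X₁(μ)`, `X̃₂(μ+η−1)·(μ+η) = X₂(μ)·(μ+1)`
(`symX₀_image`, `symX₁_image`, `symX₂_image`). Consequently the **partner coefficients**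
`b_k = c_k · ∏_{i<k}(ρ+1+i) · ∏_{k≤i≤D}(ρ+η+i)` (`partnerCoeff`, for `c` supported in `k ≤ D`)
satisfy `recCoeff(image, ρ+η−1, b)_{n+1} = W_n · recCoeff(source, ρ, c)_{n+1}` (`recCoeff_partner_succ`)
and `recCoeff(image, ρ+η−1, b)_0 = 0` when `ρ = 1−δ` (`recCoeff_partner_zero`): a formal solution
`t^ρ·(polynomial)` of the source equation yields the formal solution `t^{ρ+η−1}·(polynomial)` of the
image equation (`recCoeff_partner_eq_zero`) — the termwise (Beta-function) action of Euler's
transformation on Frobenius series, valid without any convergence condition on `Re ρ`. The weights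
do not vanish off the resonances `ρ+1+i = 0`, `ρ+η+i = 0` (`partnerWeight_ne_zero`). 0 cited facts.

References: K. Takemura, *Integral transformation of Heun's equation and some applications*,
J. Math. Soc. Japan 69 (2017) 849–891 [Takemura2017], Proposition 1.2 (parameter map, as vendored in
`Literature/Analysis/ODE/HeunEulerKernel.lean`); H. Umetsu, Prog. Theor. Phys. 104 (2000) 743
[Umetsu2000] §3 (normalisation).
-/

noncomputable section

open Finset

namespace Summit.Ventures.KdS

namespace SpinFlipTS

open Literature.Analysis.ODE Literature.Analysis.ODE.GeneralHeun

/-! ### The monomial symbol of Umetsu's operator at `t = w − 1` -/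

/-- `X₀(μ) = (1 − a_H)·μ·(μ − 1 + δ)`: the coefficient of `t^{μ−1}` in `M[(w−1)^μ]`. -/
def symX₀ (aH δ μ : ℂ) : ℂ := (1 - aH) * μ * (μ - 1 + δ)

/-- `X₁(μ) = (2 − a_H)μ(μ−1) + [γ(1−a_H) + δ(2−a_H) + ε]μ + αβ + q`: the coefficient of `t^{μ}`. -/
def symX₁ (aH α β γ δ ε q μ : ℂ) : ℂ :=
  (2 - aH) * μ * (μ - 1) + (γ * (1 - aH) + δ * (2 - aH) + ε) * μ + α * β + q

/-- `X₂(μ) = μ(μ−1) + (γ+δ+ε)μ + αβ` (the coefficient of `t^{μ+1}`; `= (μ+α)(μ+β)` under the Fuchs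
relation, `symX₂_eq_mul`). -/
def symX₂ (α β γ δ ε μ : ℂ) : ℂ := μ * (μ - 1) + (γ + δ + ε) * μ + α * β

/-- Under the Fuchs relation `X₂(μ) = (μ+α)(μ+β)` (the indicial polynomial at infinity). -/
theorem symX₂_eq_mul {α β γ δ ε : ℂ} (hF : γ + δ + ε = α + β + 1) (μ : ℂ) :
    symX₂ α β γ δ ε μ = (μ + α) * (μ + β) := by
  unfold symX₂; linear_combination μ * hF

/-- `X₀` vanishes at the local exponent `1 − δ` of `w = 1`. -/
theorem symX₀_one_sub (aH δ : ℂ) : symX₀ aH δ (1 - δ) = 0 := by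
  unfold symX₀; ring

/-! ### The three-term recurrence -/

/-- **Recurrence coefficients.** For a coefficient sequence `c` and an exponent `μ`,
`M[Σ_k c_k t^{μ+k}] = t^{μ−1}·Σ_n recCoeff_n t^n` with
`recCoeff_n = c_n X₀(μ+n) + c_{n−1} X₁(μ+n−1) + c_{n−2} X₂(μ+n−2)` (absent terms omitted for
`n = 0, 1`). -/
def recCoeff (aH α β γ δ ε q μ : ℂ) (c : ℕ → ℂ) : ℕ → ℂ
  | 0 => c 0 * symX₀ aH δ μ
  | 1 => c 1 * symX₀ aH δ (μ + 1) + c 0 * symX₁ aH α β γ δ ε q μ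
  | n + 2 => c (n + 2) * symX₀ aH δ (μ + (n + 2)) +
      c (n + 1) * symX₁ aH α β γ δ ε q (μ + (n + 1)) + c n * symX₂ α β γ δ ε (μ + n)

/-- Beyond the support of `c` the recurrence coefficients vanish. -/
theorem recCoeff_eq_zero_of_le {aH α β γ δ ε q μ : ℂ} {c : ℕ → ℂ} {K : ℕ}
    (hc : ∀ k, K ≤ k → c k = 0) {n : ℕ} (hn : K + 2 ≤ n) :
    recCoeff aH α β γ δ ε q μ c n = 0 := by
  obtain ⟨m, rfl⟩ : ∃ m, n = m + 2 := ⟨n - 2, by omega⟩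
  simp only [recCoeff]
  rw [hc (m + 2) (by omega), hc (m + 1) (by omega), hc m (by omega)]
  ring

/-! ### The partner weights -/

/-- **Partner weights** `W_k = ∏_{i<k}(ρ+1+i) · ∏_{k≤i≤D}(ρ+η+i)` (the termwise action of Euler's
transformation with exponent `η` on `t^{ρ+k}`, cleared of denominators over `0 ≤ k ≤ D`). -/
def partnerWeight (ρ η : ℂ) (D k : ℕ) : ℂ :=
  (∏ i ∈ range k, (ρ + 1 + i)) * ∏ i ∈ Ico k (D + 1), (ρ + η + i)

/-- **Partner coefficients** `b_k = c_k · W_k`. -/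
def partnerCoeff (ρ η : ℂ) (D : ℕ) (c : ℕ → ℂ) (k : ℕ) : ℂ := c k * partnerWeight ρ η D k

/-- The ratio rule `W_{k+1}·(ρ+η+k) = W_k·(ρ+1+k)` for `k ≤ D`. -/
theorem partnerWeight_succ (ρ η : ℂ) {D k : ℕ} (hk : k ≤ D) :
    partnerWeight ρ η D (k + 1) * (ρ + η + k) = partnerWeight ρ η D k * (ρ + 1 + k) := by
  unfold partnerWeight
  rw [prod_range_succ, prod_eq_prod_Ico_succ_bot (Nat.lt_succ_of_le hk)]
  ring

/-- `W_0 = ∏_{i ≤ D}(ρ+η+i)`. -/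
theorem partnerWeight_zero (ρ η : ℂ) (D : ℕ) :
    partnerWeight ρ η D 0 = ∏ i ∈ range (D + 1), (ρ + η + i) := by
  unfold partnerWeight
  rw [prod_range_zero, one_mul, range_eq_Ico]

/-- Off the resonances `ρ+1+i = 0`, `ρ+η+i = 0` (`i ∈ ℕ`) no weight vanishes. -/
theorem partnerWeight_ne_zero {ρ η : ℂ} (h1 : ∀ i : ℕ, ρ + 1 + i ≠ 0)
    (h2 : ∀ i : ℕ, ρ + η + i ≠ 0) (D k : ℕ) : partnerWeight ρ η D k ≠ 0 := by
  unfold partnerWeight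
  exact mul_ne_zero (prod_ne_zero_iff.mpr fun i _ => h1 i) (prod_ne_zero_iff.mpr fun i _ => h2 i)

/-- The partner coefficients are supported where `c` is. -/
theorem partnerCoeff_eq_zero {ρ η : ℂ} {D : ℕ} {c : ℕ → ℂ} {k : ℕ} (hk : c k = 0) :
    partnerCoeff ρ η D c k = 0 := by
  unfold partnerCoeff; rw [hk, zero_mul]

/-- Off the resonances, `b_k = 0` forces `c_k = 0`. -/
theorem eq_zero_of_partnerCoeff_eq_zero {ρ η : ℂ} (h1 : ∀ i : ℕ, ρ + 1 + i ≠ 0)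
    (h2 : ∀ i : ℕ, ρ + η + i ≠ 0) {D : ℕ} {c : ℕ → ℂ} {k : ℕ}
    (hk : partnerCoeff ρ η D c k = 0) : c k = 0 :=
  (mul_eq_zero.mp hk).resolve_right (partnerWeight_ne_zero h1 h2 D k)

/-! ### Takemura's image symbol -/

/-- `X̃₀(μ+η−1) = (1−a_H)(μ+η−1)(μ−1+δ)`, hence `X̃₀(μ+η−1)·μ = X₀(μ)·(μ+η−1)`. -/
theorem symX₀_image (aH δ η μ : ℂ) :
    symX₀ aH (eulerSrc δ η) (μ + η - 1) = (1 - aH) * (μ + η - 1) * (μ - 1 + δ) := by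
  unfold symX₀ eulerSrc; ring

/-- `X̃₁(μ+η−1) = X₁(μ) − (η−α)(η−β)` (Fuchs relation). -/
theorem symX₁_image {α β γ δ ε : ℂ} (aH q η μ : ℂ) (hF : γ + δ + ε = α + β + 1) :
    symX₁ aH (eulerSrcα η) (eulerSrcβ α β η) (eulerSrc γ η) (eulerSrc δ η) (eulerSrc ε η)
        (eulerSrcQ aH γ δ ε q η) (μ + η - 1) =
      symX₁ aH α β γ δ ε q μ - (η - α) * (η - β) := by
  unfold symX₁ eulerSrcα eulerSrcβ eulerSrc eulerSrcQ
  linear_combination (2 * (η - 1)) * hF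

/-- `X̃₂(μ+η−1) = (μ+1)(μ+α+β−η)` (Fuchs relation), hence, when `(η−α)(η−β) = 0`,
`X̃₂(μ+η−1)·(μ+η) = X₂(μ)·(μ+1)`. -/
theorem symX₂_image {α β γ δ ε : ℂ} (η μ : ℂ) (hF : γ + δ + ε = α + β + 1) :
    symX₂ (eulerSrcα η) (eulerSrcβ α β η) (eulerSrc γ η) (eulerSrc δ η) (eulerSrc ε η)
        (μ + η - 1) = (μ + 1) * (μ + α + β - η) := by
  unfold symX₂ eulerSrcα eulerSrcβ eulerSrc
  linear_combination (μ + η - 1) * hF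

/-! ### The intertwining of the recurrences -/

section Intertwine

variable {aH α β γ δ ε q η ρ : ℂ} {D : ℕ} {c : ℕ → ℂ}

/-- At `n = 0` both recurrence coefficients vanish when `ρ = 1 − δ` is the local exponent
(`X₀(ρ) = 0 = X̃₀(ρ+η−1)`). -/
theorem recCoeff_partner_zero (hρ : ρ = 1 - δ) :
    recCoeff aH (eulerSrcα η) (eulerSrcβ α β η) (eulerSrc γ η) (eulerSrc δ η) (eulerSrc ε η)
        (eulerSrcQ aH γ δ ε q η) (ρ + η - 1) (partnerCoeff ρ η D c) 0 = 0 := by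
  simp only [recCoeff]
  unfold symX₀ eulerSrc
  rw [hρ]; ring

/-- **Termwise intertwining.** For `c` supported in `k ≤ D`, the Fuchs relation and
`(η−α)(η−β) = 0`: `recCoeff(image, ρ+η−1, b)_{n+1} = W_n · recCoeff(source, ρ, c)_{n+1}` for every
`n` (no condition on `ρ`). -/
theorem recCoeff_partner_succ (hF : γ + δ + ε = α + β + 1) (hroot : (η - α) * (η - β) = 0)
    (hc : ∀ k, D < k → c k = 0) (n : ℕ) :
    recCoeff aH (eulerSrcα η) (eulerSrcβ α β η) (eulerSrc γ η) (eulerSrc δ η) (eulerSrc ε η)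
        (eulerSrcQ aH γ δ ε q η) (ρ + η - 1) (partnerCoeff ρ η D c) (n + 1) =
      partnerWeight ρ η D n * recCoeff aH α β γ δ ε q ρ c (n + 1) := by
  -- the `X₀`-terms: `b_{k+1} X̃₀(ρ+η+k) = W_k c_{k+1} X₀(ρ+k+1)` for every `k`
  have hT0 : ∀ k : ℕ, partnerCoeff ρ η D c (k + 1) * symX₀ aH (eulerSrc δ η) (ρ + η - 1 + (k + 1)) =
      partnerWeight ρ η D k * (c (k + 1) * symX₀ aH δ (ρ + (k + 1))) := by
    intro k
    have e1 : symX₀ aH (eulerSrc δ η) (ρ + η - 1 + (k + 1)) =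
        (1 - aH) * (ρ + η + k) * (ρ + k + δ) := by
      unfold symX₀ eulerSrc; ring
    have e2 : symX₀ aH δ (ρ + (k + 1)) = (1 - aH) * (ρ + 1 + k) * (ρ + k + δ) := by
      unfold symX₀; ring
    rw [e1, e2]
    unfold partnerCoeff
    by_cases hk : k ≤ D
    · have hW := partnerWeight_succ ρ η hk
      linear_combination c (k + 1) * (1 - aH) * (ρ + ↑k + δ) * hW
    · rw [hc (k + 1) (by omega)]; ring
  -- the `X₁`-terms: `b_k X̃₁(ρ+η−1+k) = W_k c_k X₁(ρ+k)` for every `k`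
  have hT1 : ∀ k : ℕ, partnerCoeff ρ η D c k *
      symX₁ aH (eulerSrcα η) (eulerSrcβ α β η) (eulerSrc γ η) (eulerSrc δ η) (eulerSrc ε η)
        (eulerSrcQ aH γ δ ε q η) (ρ + η - 1 + k) =
      partnerWeight ρ η D k * (c k * symX₁ aH α β γ δ ε q (ρ + k)) := by
    intro k
    have e1 := symX₁_image aH q η (ρ + k) hF
    rw [show ρ + η - 1 + (k : ℂ) = ρ + k + η - 1 by ring, e1, hroot, sub_zero]
    unfold partnerCoeff; ring
  -- the `X₂`-terms: `b_k X̃₂(ρ+η−1+k) = W_{k+1} c_k X₂(ρ+k)` for every `k`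
  have hT2 : ∀ k : ℕ, partnerCoeff ρ η D c k *
      symX₂ (eulerSrcα η) (eulerSrcβ α β η) (eulerSrc γ η) (eulerSrc δ η) (eulerSrc ε η)
        (ρ + η - 1 + k) =
      partnerWeight ρ η D (k + 1) * (c k * symX₂ α β γ δ ε (ρ + k)) := by
    intro k
    have e1 := symX₂_image η (ρ + k) hF
    rw [show ρ + η - 1 + (k : ℂ) = ρ + k + η - 1 by ring, e1, symX₂_eq_mul hF]
    unfold partnerCoeff
    by_cases hk : k ≤ D
    · have hW := partnerWeight_succ ρ η hk
      linear_combination -(c k * (ρ + ↑k + α + β - η)) * hW -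
        c k * partnerWeight ρ η D (k + 1) * hroot
    · rw [hc k (by omega)]; ring
  cases n with
  | zero =>
    simp only [recCoeff]
    have h0 := hT0 0
    have h1 := hT1 0
    push_cast at h0 h1 ⊢
    simp only [add_zero, zero_add] at h0 h1 ⊢
    linear_combination h0 + h1
  | succ m =>
    simp only [recCoeff]
    have h0 := hT0 (m + 1)
    have h1 := hT1 (m + 1)
    have h2 := hT2 m
    push_cast at h0 h1 h2 ⊢
    have e3 : ρ + η - 1 + ((m : ℂ) + 1 + 1) = ρ + η - 1 + ((m : ℂ) + 2) := by ring
    have e4 : ρ + ((m : ℂ) + 1 + 1) = ρ + ((m : ℂ) + 2) := by ring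
    rw [e3, e4] at h0
    linear_combination h0 + h1 + h2

/-- **A formal solution yields a formal partner solution.** If all source recurrence coefficients
vanish (so `t^ρ Σ c_k t^k` is annihilated by `M` termwise) and `ρ = 1−δ`, then all image recurrence
coefficients of the partner vanish. -/
theorem recCoeff_partner_eq_zero (hF : γ + δ + ε = α + β + 1) (hroot : (η - α) * (η - β) = 0)
    (hρ : ρ = 1 - δ) (hc : ∀ k, D < k → c k = 0)
    (hsrc : ∀ n, recCoeff aH α β γ δ ε q ρ c n = 0) (n : ℕ) :
    recCoeff aH (eulerSrcα η) (eulerSrcβ α β η) (eulerSrc γ η) (eulerSrc δ η) (eulerSrc ε η)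
        (eulerSrcQ aH γ δ ε q η) (ρ + η - 1) (partnerCoeff ρ η D c) n = 0 := by
  cases n with
  | zero => exact recCoeff_partner_zero hρ
  | succ m => rw [recCoeff_partner_succ hF hroot hc m, hsrc (m + 1), mul_zero]

end Intertwine

end SpinFlipTS

end Summit.Ventures.KdS
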